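import Literature.Topology.FourManifolds.BandSumDetour
import HarnessLib

/-!
# The detour of a band sum in a foliated chart, II: the glued curve

Topic `Literature/Topology/FourManifolds`; sequel of `BandSumDetour.lean` in the decomposition of
the Fox–Milnor congruence `Literature.Topology.FourManifolds.Knot.IsConnectedSum.isConcordant`.
Everything here is proved.

Given a band chart `C : ChartData`, segment data `D : SegData C` and a `KnotPiece C D` — the small
copy `k` of the second summand in model coordinates: a `C^∞` regular `2π`-periodic curve in
`ℝ³`, injective modulo the period, flat (`k θ = (S θ, a, 0)`) over the window `[α, β]` and at
heights `≥ a` — we build **the connected-sum curve in the model**: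

* `KnotPiece.curve` — the glued curve over one period: the core line `u ↦ (u, 0, 0)` for
  `u ≤ θlo`, the lower arch `B ∘ cLo` over `[θlo, uA]`, the small knot the long way round
  `k ∘ θhat` over `[uA, uD]`, the upper arch `B ∘ cUp` over `[uD, θhi]`, the core again.
  Consecutive pieces *coincide as parametrised curves on open overlaps* (`pLo_eq_core`,
  `pLo_eq_pMid`, `pMid_eq_pUp`, `pUp_eq_core` — this is what the junction formulas of part I were
  for), so the glued curve is `C^∞` (`contDiff_curve`) and regular (`deriv_curve_ne_zero`: the
  chart is an immersion on the open collar, the arches and `θhat` are regular); it is injective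
  (`curve_injective`: `θ`-coordinates and heights separate the pieces, the small knot is
  injective along the extended middle range because that range is shorter than a period,
  `pMid_ne`), and it is the core outside `(θlo, θhi)` (`curve_eq_core`).
* `KnotPiece.per` — the periodisation `per u = curve (u - idx u) + idx u • e₀` with period index
  `idx u = ⌊u - θlo + 1/2⌋`: `C^∞` (`contDiff_per`, the index is locally constant away from the
  window ends, where the curve is the core on both sides), regular, equivariant
  (`per (u + 1) = per u + e₀`), equal to the core when no translate of `u` meets `(θlo, θhi)`,
  and injective (`per_injective`) when `θlo, θhi ∈ (-1/4, 1/4)` and the `θ`-coordinates of the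
  small knot stay in the period window.
* `KnotPiece.curve_cases` — every point of the curve is a core point, a chart point `B x` with
  `x 0 ∈ [0, 1]`, `x 1 ∈ [-δ, 1 + δ]`, or a point of the small knot (used for the tube bounds of the
  detour in the sequel).

## References

* P. R. Cromwell, *Knots and Links* (2004), §4.6. [Cromwell2004]
* R. H. Fox, J. W. Milnor, Osaka J. Math. 3 (1966), §1 (the consumer). [FoxMilnor1966]
-/

open Set Function
open scoped Topology ContDiff

noncomputable section

namespace Literature.Topology.FourManifolds

namespace BandFoliation

open ChartData (e3)

/-- Local notation: `𝔼 n` is the model Euclidean space `EuclideanSpace ℝ (Fin n)`. -/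
local notation "𝔼 " n:arg => EuclideanSpace ℝ (Fin n)

/-! ### The small knot relative to the chart -/

/-- **The small copy of the second summand in model coordinates**, relative to a band chart `C`
and segment data `D`: a `C^∞` regular `2π`-periodic curve `k` in `ℝ³`, injective modulo the
period, whose flat part over the window `[α, β]` is the line at height `a`:
`k θ = (S θ, a, 0)`, and which stays at heights `≥ a`. [folklore] -/
structure KnotPiece (C : ChartData) (D : SegData C) where
  /-- The curve. -/
  k : ℝ → 𝔼 3
  contDiff_k : ContDiff ℝ ∞ k
  periodic_k : Periodic k (2 * Real.pi)
  deriv_k_ne_zero : ∀ θ, deriv k θ ≠ 0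
  k_inj : ∀ s t, k s = k t → ∃ m : ℤ, t = s + m * (2 * Real.pi)
  flat : ∀ θ ∈ Icc D.α D.β, k θ = D.S θ • e3 0 + C.a • e3 1
  above : ∀ θ, C.a ≤ k θ 1

namespace KnotPiece

variable {C : ChartData} {D : SegData C} (P : KnotPiece C D)

/-- The flat formula one period up. [folklore] -/
theorem flat' {θ : ℝ} (hθ : θ - 2 * Real.pi ∈ Icc D.α D.β) :
    P.k θ = D.S (θ - 2 * Real.pi) • e3 0 + C.a • e3 1 := by
  rw [← P.flat _ hθ, ← P.periodic_k (θ - 2 * Real.pi), sub_add_cancel]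

/-! ### The five pieces -/

/-- **The core line** `u ↦ (u, 0, 0)`. [folklore] -/
def core (u : ℝ) : 𝔼 3 := u • e3 0

/-- The lower arch piece: `u ↦ B (cLo ((u - θlo)/c₁))`. [folklore] -/
def pLo (u : ℝ) : 𝔼 3 := C.B (D.cLo ((u - C.θlo) / D.c₁))

/-- The middle piece: `u ↦ k (θ̂ u)`. [folklore] -/
def pMid (u : ℝ) : 𝔼 3 := P.k (D.θhat u)

/-- The upper arch piece: `u ↦ B (cUp ((u - uD)/c₁))`. [folklore] -/
def pUp (u : ℝ) : 𝔼 3 := C.B (D.cUp ((u - D.uD) / D.c₁))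

/-- **The detour over one period**: core, lower arch, middle, upper arch, core. [folklore] -/
def curve (u : ℝ) : 𝔼 3 :=
  if u ≤ C.θlo then core u
  else if u ≤ D.uA then pLo (D := D) u
  else if u ≤ D.uD then P.pMid u
  else if u ≤ C.θhi then pUp (D := D) u
  else core u

/-! ### Chart values on the edge lines -/

/-- **The chart on the left edge line is the core**: `B (0, x₁) = (θaff x₁, 0, 0)` for `x₁` in the
clamp range. [folklore] -/
theorem B_pt2_zero {x₁ : ℝ} (hx : x₁ ∈ Icc (-(1 + 2 * C.δ)) (2 + 2 * C.δ)) :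
    C.B (pt2 0 x₁) = C.θaff x₁ • e3 0 := by
  have h0 : C.F (pt2 0 x₁) = 0 := C.F_of_zero rfl
  have hΘ : C.Θ (pt2 0 x₁) = C.θaff x₁ := C.Θ_eq (by simpa using hx)
  rw [ChartData.B, h0, hΘ, zero_smul, add_zero]

/-- **The chart on the right edge line is the line at height `a`**: `B (1, x₁) = (θaff x₁, a, 0)`.
[folklore] -/
theorem B_pt2_one {x₁ : ℝ} (hx : x₁ ∈ Icc (-(1 + 2 * C.δ)) (2 + 2 * C.δ)) :
    C.B (pt2 1 x₁) = C.θaff x₁ • e3 0 + C.a • e3 1 := by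
  have h1 : C.F (pt2 1 x₁) = C.a := C.F_of_one rfl
  have hΘ : C.Θ (pt2 1 x₁) = C.θaff x₁ := C.Θ_eq (by simpa using hx)
  rw [ChartData.B, h1, hΘ]

/-- The left profile stays in the clamp range for `t ∈ [-1, 2]`. [folklore] -/
theorem fLo_mem {t : ℝ} (ht : t ∈ Icc (-1 : ℝ) 2) : D.fLo t ∈ Icc (-(1 + 2 * C.δ)) (2 + 2 * C.δ) := by
  have hv := D.v_pos; have hv' := D.v_le; have hδ := C.δ_pos
  rw [SegData.fLo]
  constructor <;> nlinarith [ht.1, ht.2]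

/-- The lower end profile stays in the clamp range for `t ∈ [0, 3/2]`. [folklore] -/
theorem E_mem' {t : ℝ} (ht : t ∈ Icc (0 : ℝ) (3 / 2)) : D.E t ∈ Icc (-(1 + 2 * C.δ)) (2 + 2 * C.δ) := by
  have h := D.abs_E_add_δ_lt ht
  rw [abs_lt] at h
  have hδ := C.δ_pos; have hδ' := C.δ_le
  constructor <;> linarith [h.1, h.2]

/-- The upper end profile stays in the clamp range for `t ∈ [-1/2, 1]`. [folklore] -/
theorem Eup_mem' {t : ℝ} (ht : t ∈ Icc (-(1 / 2) : ℝ) 1) : D.Eup t ∈ Icc (-(1 + 2 * C.δ)) (2 + 2 * C.δ) := by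
  have h := D.abs_Eup_sub_lt ht
  rw [abs_lt] at h
  have hδ := C.δ_pos; have hδ' := C.δ_le
  constructor <;> linarith [h.1, h.2]

/-- `θaffInv u` stays in the clamp range for `u ∈ [θlo, θhi + wid/2]`. [folklore] -/
theorem θaffInv_mem {u : ℝ} (hu : u ∈ Icc C.θlo (C.θhi + C.wid / 2)) :
    C.θaffInv u ∈ Icc (-(1 + 2 * C.δ)) (2 + 2 * C.δ) := by
  have hs := C.slope_pos'
  have hδ := C.δ_pos
  have h1 : C.θaffInv C.θlo ≤ C.θaffInv u := by
    rw [← sub_nonneg, ChartData.θaffInv_sub]; exact div_nonneg (by linarith [hu.1]) hs.le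
  have h2 : C.θaffInv u - C.θaffInv C.θhi ≤ (C.wid / 2) / C.slope := by
    rw [ChartData.θaffInv_sub]; exact div_le_div_of_nonneg_right (by linarith [hu.2]) hs.le
  rw [ChartData.θaffInv_θlo] at h1
  rw [ChartData.θaffInv_θhi] at h2
  have e : (C.wid / 2) / C.slope = (1 + 2 * C.δ) / 2 := by
    rw [ChartData.slope]
    have : (1 + 2 * C.δ) ≠ 0 := by linarith
    have hw : C.wid ≠ 0 := C.wid_pos.ne'
    field_simp
  rw [e] at h2
  constructor <;> linarith

/-! ### Local agreement of consecutive pieces -/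

/-- **Core and lower arch agree near `θlo`**: for `u ∈ (θlo - c₁, θlo + c₁/8]`, `pLo u = core u`.
[folklore] -/
theorem pLo_eq_core {u : ℝ} (hu : u ∈ Ioc (C.θlo - D.c₁) (C.θlo + D.c₁ / 8)) : pLo (D := D) u = core u := by
  have hc := D.c₁_pos
  set t := (u - C.θlo) / D.c₁ with ht
  have ht' : t ∈ Ioc (-1 : ℝ) (1 / 8) := by
    rw [ht]; constructor
    · rw [lt_div_iff₀ hc]; linarith [hu.1]
    · rw [div_le_iff₀ hc]; linarith [hu.2]
  have hu' : u = C.θlo + D.c₁ * t := by rw [ht]; field_simp; ring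
  rw [pLo, ← ht, D.cLo_of_le ht'.2, B_pt2_zero (fLo_mem ⟨ht'.1.le, by linarith [ht'.2]⟩),
    D.θaff_fLo, core, hu']

/-- **Lower arch and middle piece agree near `uA`**: for `u ∈ [θlo + 7c₁/8, θlo + 5c₁/4]`,
`pLo u = pMid u`. [folklore] -/
theorem pLo_eq_pMid {u : ℝ} (hu : u ∈ Icc (C.θlo + 7 / 8 * D.c₁) (C.θlo + 5 / 4 * D.c₁)) :
    pLo (D := D) u = P.pMid u := by
  have hc := D.c₁_pos
  set t := (u - C.θlo) / D.c₁ with ht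
  have ht' : t ∈ Icc (7 / 8 : ℝ) (5 / 4) := by
    rw [ht]; constructor
    · rw [le_div_iff₀ hc]; linarith [hu.1]
    · rw [div_le_iff₀ hc]; linarith [hu.2]
  have hu' : u = C.θlo + D.c₁ * t := by rw [ht]; field_simp; ring
  have hwin := (D.θhat_lo (t := t) ⟨by linarith [ht'.1], by linarith [ht'.2]⟩).2
  rw [pLo, ← ht, D.cLo_of_mem ht', B_pt2_one (E_mem' ⟨by linarith [ht'.1], by linarith [ht'.2]⟩), pMid, hu',
    P.flat _ (Ioo_subset_Icc_self (D.s₀_spec.2.1 hwin)), SegData.E, ChartData.θaff_θaffInv]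

/-- **Middle piece and upper arch agree near `uD`**: for `u ∈ [uD - c₁/4, uD + c₁/8]`,
`pMid u = pUp u`. [folklore] -/
theorem pMid_eq_pUp {u : ℝ} (hu : u ∈ Icc (D.uD - 1 / 4 * D.c₁) (D.uD + 1 / 8 * D.c₁)) :
    P.pMid u = pUp (D := D) u := by
  have hc := D.c₁_pos
  set t := (u - D.uD) / D.c₁ with ht
  have ht' : t ∈ Icc (-(1 / 4) : ℝ) (1 / 8) := by
    rw [ht]; constructor
    · rw [le_div_iff₀ hc]; linarith [hu.1]
    · rw [div_le_iff₀ hc]; linarith [hu.2]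
  have hu' : u = D.uD + D.c₁ * t := by rw [ht]; field_simp; ring
  have hwin := (D.θhat_up (t := t) ⟨by linarith [ht'.1], by linarith [ht'.2]⟩).2
  rw [pUp, ← ht, D.cUp_of_mem ht', B_pt2_one (Eup_mem' ⟨by linarith [ht'.1], by linarith [ht'.2]⟩), pMid,
    hu', P.flat' (Ioo_subset_Icc_self (D.s₀_spec.2.2.1 hwin)), SegData.Eup, ChartData.θaff_θaffInv]

/-- **Upper arch and core agree near `θhi`**: for `u ∈ [θhi - c₁/8, θhi + c₁]`, `pUp u = core u`.
[folklore] -/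
theorem pUp_eq_core {u : ℝ} (hu : u ∈ Icc (C.θhi - D.c₁ / 8) (C.θhi + D.c₁)) : pUp (D := D) u = core u := by
  have hc := D.c₁_pos
  have hc4 := D.c₁_lt
  have hw : C.wid = C.θhi - C.θlo := rfl
  set t := (u - D.uD) / D.c₁ with ht
  have ht' : 7 / 8 ≤ t := by
    rw [ht, le_div_iff₀ hc, SegData.uD]; linarith [hu.1]
  have hu' : D.uD + D.c₁ * t = u := by rw [ht]; field_simp; ring
  rw [pUp, ← ht, D.cUp_of_ge ht', hu', B_pt2_zero (θaffInv_mem ⟨?_, ?_⟩), ChartData.θaff_θaffInv, core]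
  · rw [SegData.uD] at hu'; linarith [hu.1, C.θlo_lt]
  · linarith [hu.2]

/-! ### Smoothness of the glued curve -/

/-- The core is `C^∞`. [folklore] -/
theorem contDiff_core : ContDiff ℝ ∞ core := contDiff_id.smul contDiff_const

/-- The lower arch piece is `C^∞`. [folklore] -/
theorem contDiff_pLo : ContDiff ℝ ∞ (pLo (D := D)) :=
  C.contDiff_B.comp (D.cLo_spec.1.comp ((contDiff_id.sub contDiff_const).div_const _))

/-- The middle piece is `C^∞`. [folklore] -/
theorem contDiff_pMid : ContDiff ℝ ∞ P.pMid := P.contDiff_k.comp D.contDiff_θhat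

/-- The upper arch piece is `C^∞`. [folklore] -/
theorem contDiff_pUp : ContDiff ℝ ∞ (pUp (D := D)) :=
  C.contDiff_B.comp (D.contDiff_cUp.comp ((contDiff_id.sub contDiff_const).div_const _))

/-- `uA = θlo + c₁` (definitional). [folklore] -/
theorem uA_def : D.uA = C.θlo + D.c₁ := rfl

/-- `uD = θhi - c₁` (definitional). [folklore] -/
theorem uD_def : D.uD = C.θhi - D.c₁ := rfl

/-- `wid = θhi - θlo` (definitional). [folklore] -/
theorem wid_def : C.wid = C.θhi - C.θlo := rfl

/-- Useful order facts: `θlo < uA`, `uA + c₁ < uD - c₁`, `uD < θhi`. [folklore] -/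
theorem marks : C.θlo < D.uA ∧ D.uA + D.c₁ < D.uD - D.c₁ ∧ D.uD < C.θhi :=
  ⟨by rw [uA_def]; linarith [D.c₁_pos], D.uA_lt_uD, by rw [uD_def]; linarith [D.c₁_pos]⟩

/-- **The glued curve near a point left of `θlo + c₁/8` is the core.** [folklore] -/
theorem curve_eventuallyEq_core_lo {u₀ : ℝ} (hu₀ : u₀ < C.θlo + D.c₁ / 8) : P.curve =ᶠ[𝓝 u₀] core := by
  have hc := D.c₁_pos
  filter_upwards [Iio_mem_nhds hu₀] with u hu
  have hu2 : u < C.θlo + D.c₁ / 8 := hu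
  unfold curve
  by_cases h1 : u ≤ C.θlo
  · rw [if_pos h1]
  · rw [if_neg h1, if_pos (show u ≤ D.uA by rw [uA_def]; linarith)]
    exact pLo_eq_core ⟨by push Not at h1; linarith, hu2.le⟩

/-- **The glued curve near a point of `(θlo, uA)` is the lower arch piece.** [folklore] -/
theorem curve_eventuallyEq_pLo {u₀ : ℝ} (hu₀ : u₀ ∈ Ioo C.θlo D.uA) : P.curve =ᶠ[𝓝 u₀] pLo (D := D) := by
  filter_upwards [isOpen_Ioo.mem_nhds hu₀] with u hu
  unfold curve
  rw [if_neg (not_le.2 hu.1), if_pos hu.2.le]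

/-- **The glued curve near `uA` is the middle piece** (`u₀ ∈ (θlo + 7c₁/8, θlo + 5c₁/4)`).
[folklore] -/
theorem curve_eventuallyEq_pMid_lo {u₀ : ℝ} (hu₀ : u₀ ∈ Ioo (C.θlo + 7 / 8 * D.c₁) (C.θlo + 5 / 4 * D.c₁)) :
    P.curve =ᶠ[𝓝 u₀] P.pMid := by
  have hc := D.c₁_pos
  have m2 := D.uA_lt_uD
  rw [uA_def] at m2
  filter_upwards [isOpen_Ioo.mem_nhds hu₀] with u hu
  unfold curve
  have h1 : ¬u ≤ C.θlo := by push Not; linarith [hu.1]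
  rw [if_neg h1]
  by_cases h2 : u ≤ D.uA
  · rw [if_pos h2]; exact P.pLo_eq_pMid ⟨hu.1.le, hu.2.le⟩
  · rw [if_neg h2, if_pos (show u ≤ D.uD by linarith [hu.2])]

/-- **The glued curve near a point of `(uA, uD)` is the middle piece.** [folklore] -/
theorem curve_eventuallyEq_pMid {u₀ : ℝ} (hu₀ : u₀ ∈ Ioo D.uA D.uD) : P.curve =ᶠ[𝓝 u₀] P.pMid := by
  have hc := D.c₁_pos
  filter_upwards [isOpen_Ioo.mem_nhds hu₀] with u hu
  unfold curve
  have h1 : ¬u ≤ C.θlo := by push Not; have := hu.1; rw [uA_def] at this; linarith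
  rw [if_neg h1, if_neg (not_le.2 hu.1), if_pos hu.2.le]

/-- **The glued curve near `uD` is the middle piece** (`u₀ ∈ (uD - c₁/4, uD + c₁/8)`). [folklore] -/
theorem curve_eventuallyEq_pMid_up {u₀ : ℝ} (hu₀ : u₀ ∈ Ioo (D.uD - 1 / 4 * D.c₁) (D.uD + 1 / 8 * D.c₁)) :
    P.curve =ᶠ[𝓝 u₀] P.pMid := by
  have hc := D.c₁_pos
  have m2 := D.uA_lt_uD
  have hD := uD_def (D := D)
  have hA := uA_def (D := D)
  have hw := C.θlo_lt
  filter_upwards [isOpen_Ioo.mem_nhds hu₀] with u hu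
  unfold curve
  have h1 : ¬u ≤ C.θlo := by push Not; linarith [hu.1]
  have h2 : ¬u ≤ D.uA := by push Not; linarith [hu.1]
  rw [if_neg h1, if_neg h2]
  by_cases h3 : u ≤ D.uD
  · rw [if_pos h3]
  · rw [if_neg h3, if_pos (show u ≤ C.θhi by linarith [hu.2])]
    exact (P.pMid_eq_pUp ⟨hu.1.le, hu.2.le⟩).symm

/-- **The glued curve near a point of `(uD, θhi)` is the upper arch piece.** [folklore] -/
theorem curve_eventuallyEq_pUp {u₀ : ℝ} (hu₀ : u₀ ∈ Ioo D.uD C.θhi) : P.curve =ᶠ[𝓝 u₀] pUp (D := D) := by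
  have hc := D.c₁_pos
  have m2 := D.uA_lt_uD
  have hA := uA_def (D := D)
  filter_upwards [isOpen_Ioo.mem_nhds hu₀] with u hu
  unfold curve
  have h1 : ¬u ≤ C.θlo := by push Not; linarith [hu.1]
  have h2 : ¬u ≤ D.uA := by push Not; linarith [hu.1]
  rw [if_neg h1, if_neg h2, if_neg (not_le.2 hu.1), if_pos hu.2.le]

/-- **The glued curve near a point right of `θhi - c₁/8` is the core.** [folklore] -/
theorem curve_eventuallyEq_core_up {u₀ : ℝ} (hu₀ : C.θhi - D.c₁ / 8 < u₀) : P.curve =ᶠ[𝓝 u₀] core := by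
  have hc := D.c₁_pos
  have hc4 := D.c₁_lt
  have hD := uD_def (D := D)
  have hA := uA_def (D := D)
  have hw := wid_def (C := C)
  filter_upwards [Ioi_mem_nhds hu₀] with u hu
  have hu2 : C.θhi - D.c₁ / 8 < u := hu
  unfold curve
  have h1 : ¬u ≤ C.θlo := by push Not; linarith
  have h2 : ¬u ≤ D.uA := by push Not; linarith
  have h3 : ¬u ≤ D.uD := by push Not; linarith
  rw [if_neg h1, if_neg h2, if_neg h3]
  by_cases h4 : u ≤ C.θhi
  · rw [if_pos h4]; exact pUp_eq_core ⟨hu2.le, by linarith⟩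
  · rw [if_neg h4]

/-- **The glued curve is `C^∞`.** [folklore] -/
theorem contDiff_curve : ContDiff ℝ ∞ P.curve := by
  have hc := D.c₁_pos
  have m2 := D.uA_lt_uD
  have hD := uD_def (D := D)
  have hA := uA_def (D := D)
  rw [contDiff_iff_contDiffAt]
  intro u
  -- locate `u` relative to the marks, with overlapping zones
  rcases lt_or_ge u (C.θlo + D.c₁ / 8) with h | h
  · exact contDiff_core.contDiffAt.congr_of_eventuallyEq (P.curve_eventuallyEq_core_lo h)
  rcases lt_or_ge u (C.θlo + 7 / 8 * D.c₁ + D.c₁ / 16) with h' | h'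
  · exact contDiff_pLo.contDiffAt.congr_of_eventuallyEq
      (P.curve_eventuallyEq_pLo ⟨by linarith, by linarith⟩)
  rcases lt_or_ge u (C.θlo + 5 / 4 * D.c₁) with h'' | h''
  · exact P.contDiff_pMid.contDiffAt.congr_of_eventuallyEq
      (P.curve_eventuallyEq_pMid_lo ⟨by linarith, h''⟩)
  rcases le_or_gt u (D.uD - 1 / 4 * D.c₁) with h3 | h3
  · exact P.contDiff_pMid.contDiffAt.congr_of_eventuallyEq
      (P.curve_eventuallyEq_pMid ⟨by linarith, by linarith⟩)
  rcases lt_or_ge u (D.uD + 1 / 8 * D.c₁) with h4 | h4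
  · exact P.contDiff_pMid.contDiffAt.congr_of_eventuallyEq (P.curve_eventuallyEq_pMid_up ⟨h3, h4⟩)
  rcases lt_or_ge u (C.θhi - D.c₁ / 16) with h5 | h5
  · exact contDiff_pUp.contDiffAt.congr_of_eventuallyEq
      (P.curve_eventuallyEq_pUp ⟨by linarith, by linarith⟩)
  · exact contDiff_core.contDiffAt.congr_of_eventuallyEq (P.curve_eventuallyEq_core_up (by linarith))

/-! ### Regularity of the glued curve -/

/-- The core is regular: `core' = e₀`. [folklore] -/
theorem hasDerivAt_core (u : ℝ) : HasDerivAt core (e3 0) u := by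
  have h := (hasDerivAt_id u).smul_const (e3 0 : 𝔼 3)
  rw [one_smul] at h
  exact h

/-- `e₀ ≠ 0`. [folklore] -/
theorem e3_zero_ne_zero : (e3 0 : 𝔼 3) ≠ 0 := by
  intro h; have := congrArg (fun v : 𝔼 3 ↦ v 0) h; simp [ChartData.e3] at this

/-- The lower arch piece is regular on `(θlo, uA)`: `B` is an immersion at the arch point (open
collar) and the arch is regular. [folklore] -/
theorem deriv_pLo_ne_zero {u : ℝ} (hu : u ∈ Ioo C.θlo D.uA) : deriv (pLo (D := D)) u ≠ 0 := by
  have hc := D.c₁_pos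
  set t := (u - C.θlo) / D.c₁ with ht
  have ht' : t ∈ Ioo (0 : ℝ) 1 := by
    rw [ht]; constructor
    · exact div_pos (by linarith [hu.1]) hc
    · rw [div_lt_one hc]; have := hu.2; rw [uA_def] at this; linarith
  obtain ⟨hmem, -⟩ := D.cLo_mem ht'
  -- derivative of the piece
  have hcLo : HasDerivAt D.cLo (deriv D.cLo t) t := ((D.cLo_spec.1.differentiable (by simp)) t).hasDerivAt
  have haff : HasDerivAt (fun u : ℝ ↦ (u - C.θlo) / D.c₁) (1 / D.c₁) u := by
    simpa using ((hasDerivAt_id u).sub_const C.θlo).div_const D.c₁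
  have hcomp : HasDerivAt (fun u ↦ D.cLo ((u - C.θlo) / D.c₁)) ((1 / D.c₁) • deriv D.cLo t) u :=
    hcLo.scomp u haff
  have hB := ((C.contDiff_B.differentiable (by simp)) (D.cLo t)).hasFDerivAt
  have hpLo : HasDerivAt (pLo (D := D)) (fderiv ℝ C.B (D.cLo t) ((1 / D.c₁) • deriv D.cLo t)) u :=
    hB.comp_hasDerivAt u hcomp
  rw [hpLo.deriv]
  have hinj := C.injective_fderiv_B (x := D.cLo t) (hmem 0) ⟨by linarith [(hmem 1).1, C.δ_pos],
    by linarith [(hmem 1).2, C.δ_pos]⟩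
  intro h0
  have : (1 / D.c₁) • deriv D.cLo t = 0 := hinj (by rw [h0, map_zero])
  rw [smul_eq_zero] at this
  rcases this with h | h
  · exact absurd h (one_div_ne_zero hc.ne')
  · exact D.cLo_spec.2.2.2.2.2.2.2 t h

/-- The upper arch piece is regular on `(uD, θhi)`. [folklore] -/
theorem deriv_pUp_ne_zero {u : ℝ} (hu : u ∈ Ioo D.uD C.θhi) : deriv (pUp (D := D)) u ≠ 0 := by
  have hc := D.c₁_pos
  set t := (u - D.uD) / D.c₁ with ht
  have ht' : t ∈ Ioo (0 : ℝ) 1 := by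
    rw [ht]; constructor
    · exact div_pos (by linarith [hu.1]) hc
    · rw [div_lt_one hc, uD_def]; linarith [hu.2]
  obtain ⟨hmem, -⟩ := D.cUp_mem ht'
  have hcUp : HasDerivAt D.cUp (deriv D.cUp t) t := ((D.contDiff_cUp.differentiable (by simp)) t).hasDerivAt
  have haff : HasDerivAt (fun u : ℝ ↦ (u - D.uD) / D.c₁) (1 / D.c₁) u := by
    simpa using ((hasDerivAt_id u).sub_const D.uD).div_const D.c₁
  have hcomp := hcUp.scomp (𝕜 := ℝ) u haff
  have hB := ((C.contDiff_B.differentiable (by simp)) (D.cUp t)).hasFDerivAt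
  have hpUp : HasDerivAt (pUp (D := D)) (fderiv ℝ C.B (D.cUp t) ((1 / D.c₁) • deriv D.cUp t)) u :=
    hB.comp_hasDerivAt u hcomp
  rw [hpUp.deriv]
  have hinj := C.injective_fderiv_B (x := D.cUp t) (hmem 0) ⟨by linarith [(hmem 1).1, C.δ_pos],
    by linarith [(hmem 1).2, C.δ_pos]⟩
  intro h0
  have : (1 / D.c₁) • deriv D.cUp t = 0 := hinj (by rw [h0, map_zero])
  rw [smul_eq_zero] at this
  rcases this with h | h
  · exact absurd h (one_div_ne_zero hc.ne')
  · exact D.deriv_cUp_ne_zero t h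

/-- The middle piece is regular. [folklore] -/
theorem deriv_pMid_ne_zero (u : ℝ) : deriv P.pMid u ≠ 0 := by
  have hk : HasDerivAt P.k (deriv P.k (D.θhat u)) (D.θhat u) := ((P.contDiff_k.differentiable (by simp)) _).hasDerivAt
  have h := hk.scomp u (D.hasDerivAt_θhat u)
  rw [show P.pMid = P.k ∘ D.θhat from rfl, h.deriv, ← (D.hasDerivAt_θhat u).deriv]
  exact smul_ne_zero (D.deriv_θhat_pos u).ne' (P.deriv_k_ne_zero _)

/-- **The glued curve is regular.** [folklore] -/
theorem deriv_curve_ne_zero (u : ℝ) : deriv P.curve u ≠ 0 := by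
  have hc := D.c₁_pos
  have m2 := D.uA_lt_uD
  have hD := uD_def (D := D)
  have hA := uA_def (D := D)
  have hcore : ∀ v, deriv core v ≠ 0 := fun v ↦ by rw [(hasDerivAt_core v).deriv]; exact e3_zero_ne_zero
  rcases lt_or_ge u (C.θlo + D.c₁ / 8) with h | h
  · rw [(P.curve_eventuallyEq_core_lo h).deriv_eq]; exact hcore u
  rcases lt_or_ge u (C.θlo + 7 / 8 * D.c₁ + D.c₁ / 16) with h' | h'
  · rw [(P.curve_eventuallyEq_pLo ⟨by linarith, by linarith⟩).deriv_eq]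
    exact deriv_pLo_ne_zero ⟨by linarith, by linarith⟩
  rcases lt_or_ge u (C.θlo + 5 / 4 * D.c₁) with h'' | h''
  · rw [(P.curve_eventuallyEq_pMid_lo ⟨by linarith, h''⟩).deriv_eq]; exact P.deriv_pMid_ne_zero u
  rcases le_or_gt u (D.uD - 1 / 4 * D.c₁) with h3 | h3
  · rw [(P.curve_eventuallyEq_pMid ⟨by linarith, by linarith⟩).deriv_eq]; exact P.deriv_pMid_ne_zero u
  rcases lt_or_ge u (D.uD + 1 / 8 * D.c₁) with h4 | h4
  · rw [(P.curve_eventuallyEq_pMid_up ⟨h3, h4⟩).deriv_eq]; exact P.deriv_pMid_ne_zero u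
  rcases lt_or_ge u (C.θhi - D.c₁ / 16) with h5 | h5
  · rw [(P.curve_eventuallyEq_pUp ⟨by linarith, by linarith⟩).deriv_eq]
    exact deriv_pUp_ne_zero ⟨by linarith, by linarith⟩
  · rw [(P.curve_eventuallyEq_core_up (by linarith)).deriv_eq]; exact hcore u

/-! ### Values of the pieces: coordinates -/

/-- The leaf height of a collar point lies in `[0, a]` when `x 0 ∈ [0, 1]`, vanishes iff `x 0 = 0`
and equals `a` iff `x 0 = 1`. [folklore] -/
theorem F_facts {x : EuclideanSpace ℝ (Fin 2)} (hx : x 0 ∈ Icc (0 : ℝ) 1) :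
    C.F x ∈ Icc (0 : ℝ) C.a ∧ (C.F x = 0 → x 0 = 0) ∧ (C.F x = C.a → x 0 = 1) := by
  have ha := C.a_pos
  obtain ⟨hg, hg'⟩ := C.G_mem x
  have hx' : x 0 ∈ Icc (-C.δ) (1 + C.δ) := ⟨by linarith [hx.1, C.δ_pos], by linarith [hx.2, C.δ_pos]⟩
  rw [C.F_eq hx']
  have hmono := strictMonoOn_leaf ha hg hg'
  have hq1 : C.G x / C.a < 1 := by rw [div_lt_one ha]; exact hg'
  have h0 : -(1 - C.G x / C.a) / 2 ≤ 0 := by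
    have : 0 ≤ 1 - C.G x / C.a := by linarith
    linarith
  have hmem0 : (0 : ℝ) ∈ Ici (-(1 - C.G x / C.a) / 2) := h0
  have hmemx : x 0 ∈ Ici (-(1 - C.G x / C.a) / 2) := le_trans h0 hx.1
  have hmem1 : (1 : ℝ) ∈ Ici (-(1 - C.G x / C.a) / 2) := le_trans h0 zero_le_one
  refine ⟨leaf_mem ha hg hg' hx, fun h ↦ ?_, fun h ↦ ?_⟩
  · have h' : leaf C.a (C.G x) (x 0) = leaf C.a (C.G x) 0 := by rw [leaf_zero]; exact h
    exact hmono.injOn hmemx hmem0 h'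
  · have h' : leaf C.a (C.G x) (x 0) = leaf C.a (C.G x) 1 := by
      rw [leaf_one ha.ne' (by linarith : C.G x ≠ 0)]; exact h
    exact hmono.injOn hmemx hmem1 h'

/-- The first coordinate of the lower arch is `1` only in the end zone `t ≥ 7/8`. [folklore] -/
theorem cLo_zero_eq_one {t : ℝ} (h : D.cLo t 0 = 1) : 7 / 8 ≤ t := by
  by_contra hlt; push Not at hlt
  rcases le_or_gt t (1 / 8) with h1 | h1
  · rw [D.cLo_of_le h1] at h; simp at h
  · have := D.cLo_spec.2.2.2.1 t ⟨by linarith, by linarith⟩; rw [h] at this; exact lt_irrefl _ this.2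

/-- The first coordinate of the lower arch is `0` only in the start zone `t ≤ 1/8`. [folklore] -/
theorem cLo_zero_eq_zero {t : ℝ} (h : D.cLo t 0 = 0) : t ≤ 1 / 8 := by
  by_contra hlt; push Not at hlt
  rcases lt_or_ge t (7 / 8) with h1 | h1
  · have := D.cLo_spec.2.2.2.1 t ⟨by linarith, by linarith⟩; rw [h] at this; exact lt_irrefl _ this.1
  · rw [D.cLo_spec.2.2.1 t (by linarith)] at h; simp at h

/-- The first coordinate of the upper arch is `1` only in the start zone `t ≤ 1/8`. [folklore] -/
theorem cUp_zero_eq_one {t : ℝ} (h : D.cUp t 0 = 1) : t ≤ 1 / 8 := by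
  rw [D.cUp_apply] at h
  have h' : D.cUp' t 0 = 0 := by linarith
  by_contra hlt; push Not at hlt
  rcases lt_or_ge t (7 / 8) with h1 | h1
  · have := D.cUp'_spec.2.2.2.1 t ⟨by linarith, by linarith⟩; rw [h'] at this; exact lt_irrefl _ this.1
  · rw [D.cUp'_spec.2.2.1 t (by linarith)] at h'; simp at h'

/-- The first coordinate of the upper arch is `0` only in the end zone `t ≥ 7/8`. [folklore] -/
theorem cUp_zero_eq_zero {t : ℝ} (h : D.cUp t 0 = 0) : 7 / 8 ≤ t := by
  rw [D.cUp_apply] at h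
  have h' : D.cUp' t 0 = 1 := by linarith
  by_contra hlt; push Not at hlt
  rcases le_or_gt t (1 / 8) with h1 | h1
  · rw [D.cUp'_spec.2.1 t (by linarith)] at h'; simp at h'
  · have := D.cUp'_spec.2.2.2.1 t ⟨by linarith, by linarith⟩; rw [h'] at this; exact lt_irrefl _ this.2

/-- The lower arch over `(0, 1]`: a collar point with `x 0 ∈ [0, 1]`, `x 1 ∈ [-δ, 1/2)`. [folklore] -/
theorem cLo_coll {t : ℝ} (ht : t ∈ Ioc (0 : ℝ) 1) :
    D.cLo t 0 ∈ Icc (0 : ℝ) 1 ∧ D.cLo t 1 ∈ Ico (-C.δ) (1 / 2) := by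
  refine ⟨D.cLo_spec.2.2.2.2.1 t, ?_⟩
  rcases lt_or_eq_of_le ht.2 with h | h
  · obtain ⟨hm, hlt⟩ := D.cLo_mem ⟨ht.1, h⟩
    exact ⟨(hm 1).1.le, by norm_num at hlt; exact hlt⟩
  · rw [h, D.cLo_one]; simp; linarith [C.δ_pos]

/-- The upper arch over `(0, 1]`: a collar point with `x 0 ∈ [0, 1]`, `x 1 ∈ (1/2, 1 + δ]`. [folklore] -/
theorem cUp_coll {t : ℝ} (ht : t ∈ Ioc (0 : ℝ) 1) :
    D.cUp t 0 ∈ Icc (0 : ℝ) 1 ∧ D.cUp t 1 ∈ Ioc (1 / 2 : ℝ) (1 + C.δ) := by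
  have h0 := D.cUp'_spec.2.2.2.2.1 t
  refine ⟨?_, ?_⟩
  · rw [D.cUp_apply]; exact ⟨by linarith [h0.2], by linarith [h0.1]⟩
  rcases lt_or_eq_of_le ht.2 with h | h
  · obtain ⟨hm, hlt⟩ := D.cUp_mem ⟨ht.1, h⟩
    exact ⟨by norm_num at hlt; exact hlt, (hm 1).2.le⟩
  · rw [h, D.cUp_one]; simp; linarith [C.δ_pos]

/-- **The `θ`-coordinate of a lower arch point** (`t ∈ (0, 1]`) lies in `[θlo, θaff (1/2))`. [folklore] -/
theorem pLo_zero_mem {u : ℝ} (hu : u ∈ Ioc C.θlo D.uA) :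
    pLo (D := D) u 0 ∈ Ico C.θlo (C.θaff (1 / 2)) := by
  have hc := D.c₁_pos
  have ht : (u - C.θlo) / D.c₁ ∈ Ioc (0 : ℝ) 1 :=
    ⟨div_pos (by linarith [hu.1]) hc, by rw [div_le_one hc]; have := hu.2; rw [uA_def] at this; linarith⟩
  obtain ⟨h0, h1⟩ := cLo_coll (D := D) ht
  rw [pLo, ChartData.B_apply_zero, C.Θ_eq ⟨by linarith [h1.1, C.δ_pos], by linarith [h1.2, C.δ_pos]⟩]
  have hs := C.slope_pos
  unfold ChartData.θaff
  constructor
  · have := mul_nonneg (show (0:ℝ) ≤ D.cLo ((u - C.θlo) / D.c₁) 1 + C.δ by linarith [h1.1]) hs.le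
    linarith
  · have := mul_lt_mul_of_pos_right (show D.cLo ((u - C.θlo) / D.c₁) 1 + C.δ < 1 / 2 + C.δ by linarith [h1.2]) hs
    linarith

/-- **The `θ`-coordinate of an upper arch point** (`t ∈ (0, 1]`) lies in `(θaff (1/2), θhi]`. [folklore] -/
theorem pUp_zero_mem {u : ℝ} (hu : u ∈ Ioc D.uD C.θhi) :
    pUp (D := D) u 0 ∈ Ioc (C.θaff (1 / 2)) C.θhi := by
  have hc := D.c₁_pos
  have ht : (u - D.uD) / D.c₁ ∈ Ioc (0 : ℝ) 1 :=
    ⟨div_pos (by linarith [hu.1]) hc, by rw [div_le_one hc, uD_def]; linarith [hu.2]⟩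
  obtain ⟨h0, h1⟩ := cUp_coll (D := D) ht
  rw [pUp, ChartData.B_apply_zero, C.Θ_eq ⟨by linarith [h1.1, C.δ_pos], by linarith [h1.2, C.δ_pos]⟩]
  have hs := C.slope_pos
  have e := C.θaff_one_add_δ
  unfold ChartData.θaff at e ⊢
  constructor
  · have := mul_lt_mul_of_pos_right (show 1 / 2 + C.δ < D.cUp ((u - D.uD) / D.c₁) 1 + C.δ by linarith [h1.1]) hs
    linarith
  · have := mul_le_mul_of_nonneg_right (show D.cUp ((u - D.uD) / D.c₁) 1 + C.δ ≤ 1 + C.δ + C.δ by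
      linarith [h1.2]) hs.le
    linarith

/-- The height of a lower arch point (`t ∈ (0,1]`) is in `[0, a]`; it is `a` only in the end zone
`u ≥ θlo + 7c₁/8`, and `0` only in the start zone `u ≤ θlo + c₁/8`. [folklore] -/
theorem pLo_one_facts {u : ℝ} (hu : u ∈ Ioc C.θlo D.uA) :
    pLo (D := D) u 1 ∈ Icc (0 : ℝ) C.a ∧ (pLo (D := D) u 1 = C.a → C.θlo + 7 / 8 * D.c₁ ≤ u) ∧
      (pLo (D := D) u 1 = 0 → u ≤ C.θlo + D.c₁ / 8) := by
  have hc := D.c₁_pos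
  have ht : (u - C.θlo) / D.c₁ ∈ Ioc (0 : ℝ) 1 :=
    ⟨div_pos (by linarith [hu.1]) hc, by rw [div_le_one hc]; have := hu.2; rw [uA_def] at this; linarith⟩
  obtain ⟨h0, -⟩ := cLo_coll (D := D) ht
  obtain ⟨hF, hF0, hFa⟩ := F_facts (C := C) h0
  rw [pLo, ChartData.B_apply_one]
  refine ⟨hF, fun h ↦ ?_, fun h ↦ ?_⟩
  · have := cLo_zero_eq_one (hFa h); rw [le_div_iff₀ hc] at this; linarith
  · have := cLo_zero_eq_zero (hF0 h); rw [div_le_iff₀ hc] at this; linarith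

/-- The height of an upper arch point (`t ∈ (0,1]`) is in `[0, a]`; it is `a` only in the start
zone `u ≤ uD + c₁/8`. [folklore] -/
theorem pUp_one_facts {u : ℝ} (hu : u ∈ Ioc D.uD C.θhi) :
    pUp (D := D) u 1 ∈ Icc (0 : ℝ) C.a ∧ (pUp (D := D) u 1 = C.a → u ≤ D.uD + 1 / 8 * D.c₁) := by
  have hc := D.c₁_pos
  have ht : (u - D.uD) / D.c₁ ∈ Ioc (0 : ℝ) 1 :=
    ⟨div_pos (by linarith [hu.1]) hc, by rw [div_le_one hc, uD_def]; linarith [hu.2]⟩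
  obtain ⟨h0, -⟩ := cUp_coll (D := D) ht
  obtain ⟨hF, -, hFa⟩ := F_facts (C := C) h0
  rw [pUp, ChartData.B_apply_one]
  refine ⟨hF, fun h ↦ ?_⟩
  have := cUp_zero_eq_one (hFa h); rw [div_le_iff₀ hc] at this; linarith

/-- The height of a middle point is at least `a`. [folklore] -/
theorem a_le_pMid_one (u : ℝ) : C.a ≤ P.pMid u 1 := P.above _

/-- **Injectivity of the small knot along the extended middle range**: for
`uA - c₁/8 ≤ u < u' ≤ uD + c₁/8`, `k (θ̂ u) ≠ k (θ̂ u')` (the `θ̂`-range is shorter than a period).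
[folklore] -/
theorem pMid_ne {u u' : ℝ} (hu : D.uA - D.c₁ / 8 ≤ u) (huu' : u < u') (hu' : u' ≤ D.uD + D.c₁ / 8) :
    P.pMid u ≠ P.pMid u' := by
  intro h
  obtain ⟨m, hm⟩ := P.k_inj _ _ h
  have hlt : D.θhat u < D.θhat u' := D.strictMono_θhat huu'
  -- the range has length `< 2π`
  have hlo : D.θA - D.s₀ * D.c₁ / 8 ≤ D.θhat u := by
    have h1 : D.θhat (D.uA - D.c₁ / 8) ≤ D.θhat u := D.strictMono_θhat.monotone hu
    rw [D.θhat_of_le (u := D.uA - D.c₁ / 8) (by linarith [D.c₁_pos])] at h1; linarith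
  have hhi : D.θhat u' ≤ D.θD + 2 * Real.pi + D.s₀ * D.c₁ / 8 := by
    have h1 : D.θhat u' ≤ D.θhat (D.uD + D.c₁ / 8) := D.strictMono_θhat.monotone hu'
    rw [D.θhat_of_ge (u := D.uD + D.c₁ / 8) (by linarith [D.c₁_pos])] at h1; linarith
  have hslow := D.s₀_spec.2.2.2.2.2.2
  have hsc : 0 < D.s₀ * D.c₁ := mul_pos D.s₀_pos D.c₁_pos
  have h2π : 0 < 2 * Real.pi := by positivity
  have hm0 : (0 : ℝ) < m := by nlinarith
  have hm1 : (m : ℝ) < 1 := by nlinarith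
  have : (0 : ℤ) < m := by exact_mod_cast hm0
  have : m < (1 : ℤ) := by exact_mod_cast hm1
  omega

/-! ### Injectivity of the glued curve -/

/-- Zone values: `u ≤ θlo`. [folklore] -/
theorem curve_of_le {u : ℝ} (hu : u ≤ C.θlo) : P.curve u = core u := by
  unfold curve; rw [if_pos hu]

/-- Zone values: `θlo < u ≤ uA`. [folklore] -/
theorem curve_of_mem_lo {u : ℝ} (hu : u ∈ Ioc C.θlo D.uA) : P.curve u = pLo (D := D) u := by
  unfold curve; rw [if_neg (not_le.2 hu.1), if_pos hu.2]

/-- Zone values: `uA < u ≤ uD`. [folklore] -/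
theorem curve_of_mem_mid {u : ℝ} (hu : u ∈ Ioc D.uA D.uD) : P.curve u = P.pMid u := by
  have := (marks (D := D)).1
  unfold curve; rw [if_neg (by push Not; linarith [hu.1]), if_neg (not_le.2 hu.1), if_pos hu.2]

/-- Zone values: `uD < u ≤ θhi`. [folklore] -/
theorem curve_of_mem_up {u : ℝ} (hu : u ∈ Ioc D.uD C.θhi) : P.curve u = pUp (D := D) u := by
  obtain ⟨m1, m2, m3⟩ := marks (D := D)
  have hc := D.c₁_pos
  unfold curve
  rw [if_neg (by push Not; linarith [hu.1]), if_neg (by push Not; linarith [hu.1]), if_neg (not_le.2 hu.1),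
    if_pos hu.2]

/-- Zone values: `θhi < u`. [folklore] -/
theorem curve_of_gt {u : ℝ} (hu : C.θhi < u) : P.curve u = core u := by
  obtain ⟨m1, m2, m3⟩ := marks (D := D)
  have hc := D.c₁_pos
  unfold curve
  rw [if_neg (by push Not; linarith [C.θlo_lt]), if_neg (by push Not; linarith), if_neg (by push Not; linarith),
    if_neg (not_le.2 hu)]

/-- Coordinates of the core. [folklore] -/
@[simp] theorem core_apply_zero (u : ℝ) : core u 0 = u := by simp [core, ChartData.e3]

/-- Coordinates of the core. [folklore] -/
@[simp] theorem core_apply_one (u : ℝ) : core u 1 = 0 := by simp [core, ChartData.e3]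

/-- `θlo < θaff (1/2) < θhi`. [folklore] -/
theorem θaff_half_mem : C.θlo < C.θaff (1 / 2) ∧ C.θaff (1 / 2) < C.θhi := by
  have hs := C.slope_pos
  have hδ := C.δ_pos
  constructor
  · rw [← C.θaff_neg_δ]; unfold ChartData.θaff; nlinarith
  · rw [← C.θaff_one_add_δ]; unfold ChartData.θaff; nlinarith

/-- Lower arch points are images of collar points under the chart. [folklore] -/
theorem cLo_mem_collar {t : ℝ} (ht : t ∈ Ioc (0 : ℝ) 1) :
    D.cLo t ∈ {x : EuclideanSpace ℝ (Fin 2) | x 0 ∈ Icc (-C.δ) (1 + C.δ) ∧ x 1 ∈ Icc (-(1 + 2 * C.δ)) (2 + 2 * C.δ)} := by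
  obtain ⟨h0, h1⟩ := cLo_coll (D := D) ht
  have hδ := C.δ_pos
  exact ⟨⟨by linarith [h0.1], by linarith [h0.2]⟩, ⟨by linarith [h1.1], by linarith [h1.2]⟩⟩

/-- Upper arch points are images of collar points under the chart. [folklore] -/
theorem cUp_mem_collar {t : ℝ} (ht : t ∈ Ioc (0 : ℝ) 1) :
    D.cUp t ∈ {x : EuclideanSpace ℝ (Fin 2) | x 0 ∈ Icc (-C.δ) (1 + C.δ) ∧ x 1 ∈ Icc (-(1 + 2 * C.δ)) (2 + 2 * C.δ)} := by
  obtain ⟨h0, h1⟩ := cUp_coll (D := D) ht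
  have hδ := C.δ_pos
  exact ⟨⟨by linarith [h0.1], by linarith [h0.2]⟩, ⟨by linarith [h1.1], by linarith [h1.2]⟩⟩

/-- The lower arch piece is injective on `(θlo, uA]`. [folklore] -/
theorem pLo_injOn : InjOn (pLo (D := D)) (Ioc C.θlo D.uA) := by
  have hc := D.c₁_pos
  intro u hu u' hu' h
  have ht : (u - C.θlo) / D.c₁ ∈ Ioc (0 : ℝ) 1 :=
    ⟨div_pos (by linarith [hu.1]) hc, by rw [div_le_one hc]; have := hu.2; rw [uA_def] at this; linarith⟩
  have ht' : (u' - C.θlo) / D.c₁ ∈ Ioc (0 : ℝ) 1 :=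
    ⟨div_pos (by linarith [hu'.1]) hc, by rw [div_le_one hc]; have := hu'.2; rw [uA_def] at this; linarith⟩
  have h1 := C.injOn_B (cLo_mem_collar ht) (cLo_mem_collar ht') h
  have h2 := D.cLo_spec.2.2.2.2.2.2.1 h1
  field_simp at h2
  linarith

/-- The upper arch piece is injective on `(uD, θhi]`. [folklore] -/
theorem pUp_injOn : InjOn (pUp (D := D)) (Ioc D.uD C.θhi) := by
  have hc := D.c₁_pos
  intro u hu u' hu' h
  have ht : (u - D.uD) / D.c₁ ∈ Ioc (0 : ℝ) 1 :=
    ⟨div_pos (by linarith [hu.1]) hc, by rw [div_le_one hc, uD_def]; linarith [hu.2]⟩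
  have ht' : (u' - D.uD) / D.c₁ ∈ Ioc (0 : ℝ) 1 :=
    ⟨div_pos (by linarith [hu'.1]) hc, by rw [div_le_one hc, uD_def]; linarith [hu'.2]⟩
  have h1 := C.injOn_B (cUp_mem_collar ht) (cUp_mem_collar ht') h
  have h2 := D.injective_cUp h1
  field_simp at h2
  linarith

/-- **The glued curve is injective.** The five pieces are pairwise disjoint (their
`θ`-coordinates and heights separate them, except along the agreement zones where they coincide
as parametrised curves) and each is embedded. [folklore] -/
theorem curve_injective : Injective P.curve := by
  have hc := D.c₁_pos
  have ha := C.a_pos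
  obtain ⟨m1, m2, m3⟩ := marks (D := D)
  have hA := uA_def (D := D)
  have hD := uD_def (D := D)
  obtain ⟨hh1, hh2⟩ := θaff_half_mem (C := C)
  -- reduce to `u < u'`
  suffices key : ∀ u u', u < u' → P.curve u ≠ P.curve u' by
    intro u u' h
    by_contra hne
    rcases lt_or_gt_of_ne hne with hl | hl
    · exact key u u' hl h
    · exact key u' u hl h.symm
  intro u u' hlt heq
  have e0 := congrArg (fun q : 𝔼 3 ↦ q 0) heq
  have e1 := congrArg (fun q : 𝔼 3 ↦ q 1) heq
  simp only at e0 e1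
  -- zone of `u`
  rcases le_or_gt u C.θlo with hu | hu
  · -- `u` on the first core piece
    rw [P.curve_of_le hu, core_apply_zero] at e0
    rw [P.curve_of_le hu, core_apply_one] at e1
    rcases le_or_gt u' C.θlo with hu' | hu'
    · rw [P.curve_of_le hu', core_apply_zero] at e0; linarith
    rcases le_or_gt u' D.uA with hu'' | hu''
    · rw [P.curve_of_mem_lo ⟨hu', hu''⟩] at e0 e1
      have hz := (pLo_one_facts (D := D) ⟨hu', hu''⟩).2.2 e1.symm
      have : pLo (D := D) u' = core u' := pLo_eq_core ⟨by linarith, hz⟩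
      · rw [this, core_apply_zero] at e0; linarith
    rcases le_or_gt u' D.uD with hu3 | hu3
    · rw [P.curve_of_mem_mid ⟨hu'', hu3⟩] at e1; linarith [P.a_le_pMid_one u']
    rcases le_or_gt u' C.θhi with hu4 | hu4
    · rw [P.curve_of_mem_up ⟨hu3, hu4⟩] at e0; linarith [(pUp_zero_mem (D := D) ⟨hu3, hu4⟩).1]
    · rw [P.curve_of_gt hu4, core_apply_zero] at e0; linarith
  rcases le_or_gt u D.uA with hu2 | hu2
  · -- `u` on the lower arch
    have hu' : C.θlo < u' := by linarith
    rcases le_or_gt u' D.uA with hu'' | hu''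
    · rw [P.curve_of_mem_lo ⟨hu, hu2⟩, P.curve_of_mem_lo ⟨hu', hu''⟩] at heq
      exact absurd (pLo_injOn ⟨hu, hu2⟩ ⟨hu', hu''⟩ heq) hlt.ne
    rcases le_or_gt u' D.uD with hu3 | hu3
    · rw [P.curve_of_mem_lo ⟨hu, hu2⟩, P.curve_of_mem_mid ⟨hu'', hu3⟩] at e1 heq
      have hfa := pLo_one_facts (D := D) ⟨hu, hu2⟩
      have hea : pLo (D := D) u 1 = C.a := le_antisymm hfa.1.2 (by rw [e1]; exact P.a_le_pMid_one u')
      have h78 := hfa.2.1 hea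
      rw [P.pLo_eq_pMid ⟨h78, by linarith⟩] at heq
      exact P.pMid_ne (by linarith) hlt (by linarith) heq
    rcases le_or_gt u' C.θhi with hu4 | hu4
    · rw [P.curve_of_mem_lo ⟨hu, hu2⟩, P.curve_of_mem_up ⟨hu3, hu4⟩] at e0
      linarith [(pLo_zero_mem (D := D) ⟨hu, hu2⟩).2, (pUp_zero_mem (D := D) ⟨hu3, hu4⟩).1]
    · rw [P.curve_of_mem_lo ⟨hu, hu2⟩, P.curve_of_gt hu4, core_apply_zero] at e0
      linarith [(pLo_zero_mem (D := D) ⟨hu, hu2⟩).2]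
  rcases le_or_gt u D.uD with hu3 | hu3
  · -- `u` on the middle piece
    have hu' : D.uA < u' := by linarith
    rcases le_or_gt u' D.uD with hu'3 | hu'3
    · rw [P.curve_of_mem_mid ⟨hu2, hu3⟩, P.curve_of_mem_mid ⟨hu', hu'3⟩] at heq
      exact P.pMid_ne (by linarith) hlt (by linarith) heq
    rcases le_or_gt u' C.θhi with hu4 | hu4
    · rw [P.curve_of_mem_mid ⟨hu2, hu3⟩, P.curve_of_mem_up ⟨hu'3, hu4⟩] at e1 heq
      have hfa := pUp_one_facts (D := D) ⟨hu'3, hu4⟩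
      have hea : pUp (D := D) u' 1 = C.a := le_antisymm hfa.1.2 (by rw [← e1]; exact P.a_le_pMid_one u)
      have h18 := hfa.2 hea
      rw [← P.pMid_eq_pUp ⟨by linarith, h18⟩] at heq
      exact P.pMid_ne (by linarith) hlt (by linarith) heq
    · rw [P.curve_of_mem_mid ⟨hu2, hu3⟩, P.curve_of_gt hu4, core_apply_one] at e1
      linarith [P.a_le_pMid_one u]
  rcases le_or_gt u C.θhi with hu4 | hu4
  · -- `u` on the upper arch
    have hu' : D.uD < u' := by linarith
    rcases le_or_gt u' C.θhi with hu'4 | hu'4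
    · rw [P.curve_of_mem_up ⟨hu3, hu4⟩, P.curve_of_mem_up ⟨hu', hu'4⟩] at heq
      exact absurd (pUp_injOn ⟨hu3, hu4⟩ ⟨hu', hu'4⟩ heq) hlt.ne
    · rw [P.curve_of_mem_up ⟨hu3, hu4⟩, P.curve_of_gt hu'4, core_apply_zero] at e0
      linarith [(pUp_zero_mem (D := D) ⟨hu3, hu4⟩).2]
  · -- both on the last core piece
    rw [P.curve_of_gt hu4, P.curve_of_gt (by linarith), core_apply_zero, core_apply_zero] at e0
    linarith

/-- **Outside `[θlo, θhi]` the glued curve is the core.** [folklore] -/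
theorem curve_eq_core {u : ℝ} (hu : u ∉ Ioo C.θlo C.θhi) : P.curve u = core u := by
  rw [mem_Ioo, not_and_or, not_lt, not_lt] at hu
  rcases hu with h | h
  · exact P.curve_of_le h
  · rcases lt_or_eq_of_le h with h | h
    · exact P.curve_of_gt h
    · rw [← h, P.curve_of_mem_up ⟨(marks (D := D)).2.2, le_rfl⟩]
      exact pUp_eq_core ⟨by linarith [D.c₁_pos], by linarith [D.c₁_pos]⟩

/-! ### Periodisation -/

/-- **The period index** of `u`: the integer `n` with `u - n ∈ [θlo - 1/2, θlo + 1/2)`. [folklore] -/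
def idx (u : ℝ) : ℤ := ⌊u - C.θlo + 1 / 2⌋

/-- The reduced parameter `u - idx u` lies in the period window. [folklore] -/
theorem sub_idx_mem (u : ℝ) : u - (idx (C := C) u : ℝ) ∈ Ico (C.θlo - 1 / 2) (C.θlo + 1 / 2) := by
  have h1 := Int.floor_le (u - C.θlo + 1 / 2)
  have h2 := Int.lt_floor_add_one (u - C.θlo + 1 / 2)
  rw [idx]; constructor <;> linarith

/-- The period index of a translate. [folklore] -/
theorem idx_add_int (u : ℝ) (m : ℤ) : idx (C := C) (u + m) = idx (C := C) u + m := by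
  rw [idx, idx, show u + m - C.θlo + 1 / 2 = (u - C.θlo + 1 / 2) + m by ring, Int.floor_add_intCast]

/-- The period index is determined by the window. [folklore] -/
theorem idx_eq {u : ℝ} {n : ℤ} (h : u - n ∈ Ico (C.θlo - 1 / 2) (C.θlo + 1 / 2)) : idx (C := C) u = n := by
  rw [idx, Int.floor_eq_iff]; constructor <;> linarith [h.1, h.2]

/-- **The periodised detour** `per u = curve (u - idx u) + idx u • e₀`: the glued curve repeated
with period `1` along the core. [folklore] -/
def per (u : ℝ) : 𝔼 3 := P.curve (u - idx (C := C) u) + (idx (C := C) u : ℝ) • e3 0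

/-- **Equivariance**: `per (u + m) = per u + m • e₀`. [folklore] -/
theorem per_add_int (u : ℝ) (m : ℤ) : P.per (u + m) = P.per u + (m : ℝ) • e3 0 := by
  rw [per, per, idx_add_int]; push_cast
  rw [show u + m - (↑(idx (C := C) u) + (m : ℝ)) = u - idx (C := C) u by ring, add_smul, add_assoc]

/-- The core is equivariant. [folklore] -/
theorem core_add (u v : ℝ) : core (u + v) = core u + v • e3 0 := by rw [core, core, add_smul]

/-- **Away from the arc the periodised detour is the core**: if no integer translate of `u` lies
in `(θlo, θhi)` then `per u = core u`. [folklore] -/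
theorem per_eq_core {u : ℝ} (hu : ∀ m : ℤ, u - m ∉ Ioo C.θlo C.θhi) : P.per u = core u := by
  rw [per, P.curve_eq_core (hu _), ← core_add, sub_add_cancel]

variable (hlo : -(1 / 4 : ℝ) < C.θlo) (hhi : C.θhi < 1 / 4)
include hlo hhi

/-- **Local form of the periodisation**: near every `u₀` there is an integer `n` with
`per u = curve (u - n) + n • e₀` for `u` near `u₀`. [folklore] -/
theorem per_eventuallyEq (u₀ : ℝ) : ∃ n : ℤ, P.per =ᶠ[𝓝 u₀] fun u ↦ P.curve (u - n) + (n : ℝ) • e3 0 := by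
  have hw := C.θlo_lt
  set n := idx (C := C) u₀ with hn
  have hmem := sub_idx_mem (C := C) u₀
  rw [← hn] at hmem
  by_cases hint : C.θlo - 1 / 2 < u₀ - n
  · -- interior of the window: the index is locally constant
    refine ⟨n, ?_⟩
    have ho : IsOpen {u : ℝ | u - n ∈ Ioo (C.θlo - 1 / 2) (C.θlo + 1 / 2)} :=
      isOpen_Ioo.preimage (continuous_id.sub continuous_const)
    filter_upwards [ho.mem_nhds (show u₀ ∈ {u : ℝ | u - n ∈ Ioo (C.θlo - 1 / 2) (C.θlo + 1 / 2)} from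
      ⟨hint, hmem.2⟩)] with u hu
    rw [per, idx_eq ⟨hu.1.le, hu.2⟩]
  · -- left end of the window: both neighbouring reductions are far from the arc, where the curve
    -- is the core; use the index `n` throughout (the curve there is the core as well)
    have heq : u₀ - n = C.θlo - 1 / 2 := le_antisymm (not_lt.1 hint) hmem.1
    refine ⟨n, ?_⟩
    have ho : IsOpen {u : ℝ | u - n ∈ Ioo (C.θhi - 1) C.θlo} := isOpen_Ioo.preimage (continuous_id.sub continuous_const)
    filter_upwards [ho.mem_nhds (show u₀ ∈ {u : ℝ | u - n ∈ Ioo (C.θhi - 1) C.θlo} from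
      ⟨by rw [heq]; linarith, by rw [heq]; linarith⟩)] with u hu
    -- `per u` uses the index `n` or `n - 1`; in both cases the curve is the core
    rw [P.curve_eq_core (show u - n ∉ Ioo C.θlo C.θhi from fun h ↦ by linarith [h.1, hu.2]), ← core_add,
      sub_add_cancel]
    rcases lt_or_ge (u - n) (C.θlo - 1 / 2) with h | h
    · -- index `n - 1`
      have hidx : idx (C := C) u = n - 1 := idx_eq ⟨by push_cast; linarith [hu.1], by push_cast; linarith⟩
      rw [per, hidx, P.curve_eq_core, ← core_add]
      · congr 1; push_cast; ring
      · push_cast; intro h'; linarith [h'.2, hu.1]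
    · have hidx : idx (C := C) u = n := idx_eq ⟨h, by linarith [hu.2]⟩
      rw [per, hidx, P.curve_eq_core (show u - n ∉ Ioo C.θlo C.θhi from fun h ↦ by linarith [h.1, hu.2]),
        ← core_add, sub_add_cancel]

omit hlo hhi in
/-- A translate of the glued curve is `C^∞`. [folklore] -/
theorem contDiff_curve_shift (n : ℤ) : ContDiff ℝ ∞ fun u ↦ P.curve (u - n) + (n : ℝ) • e3 0 :=
  (P.contDiff_curve.comp (contDiff_id.sub contDiff_const)).add contDiff_const

/-- **The periodised detour is `C^∞`.** [folklore] -/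
theorem contDiff_per : ContDiff ℝ ∞ P.per := by
  rw [contDiff_iff_contDiffAt]
  intro u₀
  obtain ⟨n, hn⟩ := P.per_eventuallyEq hlo hhi u₀
  exact (P.contDiff_curve_shift n).contDiffAt.congr_of_eventuallyEq hn

omit hlo hhi in
/-- The derivative of a translate of the glued curve. [folklore] -/
theorem deriv_curve_shift (n : ℤ) (u : ℝ) :
    deriv (fun u ↦ P.curve (u - n) + (n : ℝ) • e3 0) u = deriv P.curve (u - n) := by
  have hd : HasDerivAt P.curve (deriv P.curve (u - n)) (u - n) :=
    ((P.contDiff_curve.differentiable (by simp)) _).hasDerivAt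
  have h := (hd.comp_sub_const u (n : ℝ)).add_const ((n : ℝ) • e3 0)
  exact h.deriv

/-- **The periodised detour is regular.** [folklore] -/
theorem deriv_per_ne_zero (u : ℝ) : deriv P.per u ≠ 0 := by
  obtain ⟨n, hn⟩ := P.per_eventuallyEq hlo hhi u
  rw [hn.deriv_eq, deriv_curve_shift]
  exact P.deriv_curve_ne_zero _

omit hlo hhi in
/-- **The pieces of the glued curve, as a trichotomy**: every point of the glued curve is a core
point with the same parameter, or the chart image of a collar point with `x 0 ∈ [0, 1]`,
`x 1 ∈ [-δ, 1 + δ]`, or a point of the small knot. [folklore] -/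
theorem curve_cases (v : ℝ) : P.curve v = core v ∨
    (∃ x : EuclideanSpace ℝ (Fin 2), x 0 ∈ Icc (0 : ℝ) 1 ∧ x 1 ∈ Icc (-C.δ) (1 + C.δ) ∧ P.curve v = C.B x) ∨
    ∃ θ, P.curve v = P.k θ := by
  have hc := D.c₁_pos
  rcases le_or_gt v C.θlo with h | h
  · exact Or.inl (P.curve_of_le h)
  rcases le_or_gt v D.uA with h2 | h2
  · have ht : (v - C.θlo) / D.c₁ ∈ Ioc (0 : ℝ) 1 :=
      ⟨div_pos (by linarith) hc, by rw [div_le_one hc]; have := h2; rw [uA_def] at this; linarith⟩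
    obtain ⟨h0, h1⟩ := cLo_coll (D := D) ht
    refine Or.inr (Or.inl ⟨_, h0, ⟨h1.1, by linarith [h1.2, C.δ_pos]⟩, ?_⟩)
    rw [P.curve_of_mem_lo ⟨h, h2⟩]; rfl
  rcases le_or_gt v D.uD with h3 | h3
  · exact Or.inr (Or.inr ⟨_, P.curve_of_mem_mid ⟨h2, h3⟩⟩)
  rcases le_or_gt v C.θhi with h4 | h4
  · have ht : (v - D.uD) / D.c₁ ∈ Ioc (0 : ℝ) 1 :=
      ⟨div_pos (by linarith) hc, by rw [div_le_one hc, uD_def]; linarith⟩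
    obtain ⟨h0, h1⟩ := cUp_coll (D := D) ht
    refine Or.inr (Or.inl ⟨_, h0, ⟨by linarith [h1.1, C.δ_pos], h1.2⟩, ?_⟩)
    rw [P.curve_of_mem_up ⟨h3, h4⟩]; rfl
  · exact Or.inl (P.curve_of_gt h4)

omit hlo hhi in
/-- The `θ`-coordinate of a chart point with `x 1 ∈ [-δ, 1 + δ]` lies in `[θlo, θhi]`. [folklore] -/
theorem B_zero_mem {x : EuclideanSpace ℝ (Fin 2)} (hx : x 1 ∈ Icc (-C.δ) (1 + C.δ)) : C.B x 0 ∈ Icc C.θlo C.θhi := by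
  rw [ChartData.B_apply_zero, C.Θ_eq ⟨by linarith [hx.1, C.δ_pos], by linarith [hx.2, C.δ_pos]⟩]
  have hs := C.slope_pos
  have e := C.θaff_one_add_δ
  unfold ChartData.θaff at e ⊢
  constructor
  · have := mul_nonneg (show (0 : ℝ) ≤ x 1 + C.δ by linarith [hx.1]) hs.le; linarith
  · have := mul_le_mul_of_nonneg_right (show x 1 + C.δ ≤ 1 + C.δ + C.δ by linarith [hx.2]) hs.le; linarith

/-- **The `θ`-coordinate of the glued curve stays in the period window**: for `v` in the window
`[θlo - 1/2, θlo + 1/2)`, `curve v 0 ∈ [θlo - 1/2, θlo + 1/2)`, provided the small knot's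
`θ`-coordinates do. [folklore] -/
theorem curve_zero_mem (hk : ∀ θ, P.k θ 0 ∈ Ico (C.θlo - 1 / 2) (C.θlo + 1 / 2)) {v : ℝ}
    (hv : v ∈ Ico (C.θlo - 1 / 2) (C.θlo + 1 / 2)) : P.curve v 0 ∈ Ico (C.θlo - 1 / 2) (C.θlo + 1 / 2) := by
  rcases P.curve_cases v with h | ⟨x, -, hx1, h⟩ | ⟨θ, h⟩
  · rw [h, core_apply_zero]; exact hv
  · rw [h]; have := B_zero_mem (C := C) hx1
    exact ⟨by linarith [this.1], by linarith [this.2, C.θlo_lt]⟩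
  · rw [h]; exact hk θ

/-- **The periodised detour is injective** (its `θ`-coordinate advances by `1` per period and the
glued curve is injective within a period). [folklore] -/
theorem per_injective (hk : ∀ θ, P.k θ 0 ∈ Ico (C.θlo - 1 / 2) (C.θlo + 1 / 2)) : Injective P.per := by
  intro u u' h
  have hv := sub_idx_mem (C := C) u
  have hv' := sub_idx_mem (C := C) u'
  have h0 : P.curve (u - idx (C := C) u) 0 + idx (C := C) u =
      P.curve (u' - idx (C := C) u') 0 + idx (C := C) u' := by
    have := congrArg (fun q : 𝔼 3 ↦ q 0) h
    simpa [per, ChartData.e3] using this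
  have hc := P.curve_zero_mem hlo hhi hk hv
  have hc' := P.curve_zero_mem hlo hhi hk hv'
  -- the indices agree
  have hidx : idx (C := C) u = idx (C := C) u' := by
    have h1 : ((idx (C := C) u : ℤ) : ℝ) - idx (C := C) u' < 1 := by linarith [hc.1, hc'.2]
    have h2 : -1 < ((idx (C := C) u : ℤ) : ℝ) - idx (C := C) u' := by linarith [hc.2, hc'.1]
    have h1' : idx (C := C) u - idx (C := C) u' < 1 := by exact_mod_cast h1
    have h2' : -1 < idx (C := C) u - idx (C := C) u' := by exact_mod_cast h2
    omega
  rw [per, per, hidx, add_left_inj] at h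
  have := P.curve_injective h
  linarith

omit hlo hhi in
/-- **Period one along the core**: `per (u + 1) = per u + e₀`. [folklore] -/
theorem per_add_one (u : ℝ) : P.per (u + 1) = P.per u + e3 0 := by
  have := P.per_add_int u 1; push_cast at this; rwa [one_smul] at this

omit hlo hhi in
/-- Within the window the periodisation is the glued curve. [folklore] -/
theorem per_eq_curve {u : ℝ} (hu : u ∈ Ico (C.θlo - 1 / 2) (C.θlo + 1 / 2)) : P.per u = P.curve u := by
  have : idx (C := C) u = 0 := idx_eq (by simpa using hu)
  rw [per, this]; simp

end KnotPiece

end BandFoliation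

end Literature.Topology.FourManifolds
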